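import Summits.AnomalousDissipation.AnomalousDissipation.Theorems.GalerkinSteadyZerothLaw.Negative.StokesStates
import Literature.Analysis.FluidPDE.NSGalerkinStationary

/-!
# Line `stokes-continuum-f123` — crux `MirrorVariety.GalerkinSteadyZerothLaw` (stmt-AnomalousDissipation-2986):
# reach + non-depletion of the BOUNDED STOKES CONTINUUM of the frustrated three-axis force `f₁₂₃`

Crux-strategist ALTERNATIVE line (seat s2, 2026-08-17; TRANSFER lens inside the summit).  Registered with `--alt`: it does
NOT replace the live skeleton `Lines/laminar_component_split.lean` (the cell-force decomposition R ∧ L of seat r1).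

WHY A SECOND INSTANCE.  The lead's kill test K-2 (evidence `compute-k2-interim.md`, 09:29Z) resolved the cell force's top 3-D
steady branch at `N = 12`: it is QUIET-AND-WEAK (`ε ∝ ν^1.4`, `E ∝ ν^1.25`, `Re ∈ [26, 39]`) and FOLDS at `ν_f ≈ 2.04e-3`
(`Re ≈ 38`); the `N ≤ 10` LIFE signal that motivated both live hearts (`stub_cellLoud`, `stub_reach`) was under-resolution.
Meanwhile the sibling crux `TaylorCertificates.SteadyStatesLoudBounded` (stmt-13038) produced, for the frustrated force
`f₁₂₃(x) = (sin 2πx₃, sin 4πx₁, sin 6πx₂)` (three single modes on three axes and three shells `|k| = 1, 2, 3`; not a Stokes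
eigenfunction, not Euler-steady, no planar / 2½-D reduction), the ONLY steady family in the project observed LOUD AND BOUNDED
over more than a decade of viscosity with converged numerics: its STOKES-CONNECTED branch, continued by pseudo-arclength in
`(u, log ν)` from `ν = 0.2` to `ν = 0.0021` inside the invariant sublattice class `2ℤ × 3ℤ × ℤ` (kit j019660 of lead
13038-c1, dealiased Galerkin `|k|∞ ≤ K`, `K` adaptive `8 → 24`, tails `≤ 3e-8`; re-factorised Jacobians j020781: NO fold, NO
bifurcation on `[0.0028, 0.007]`; three-code eddy-resolved confirmation to `ν = 0.004` by lead 13038-c2, j022329/j022340–2):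
`E = ∫|u|² ≤ 1.13` throughout and `D = ν‖∇u‖² = (f,u) ∈ [0.61, 0.86]` for `ν ∈ [0.002, 0.03]` (`Re = 50 → 480`), the decline of
`D` stopping (`dlogD/dlogν = +0.48 → +0.09`) and reversing (`−0.60` at `ν = 0.0021`), enstrophy `∝ ν^{−0.9…−1.6}` (bulk fine
structure, steeper than one `√ν` layer).  (`Cruxes/SteadyStatesLoudBounded/Lines/lamb-floor-f123-shared-ceiling-S1-c1.md` §4a,
`…/STRATEGY-CENSUS.md` v4 §0.)

OBJECT.  The force vector `C₁₂₃` (explicit lambda below: `∓(i/2)e₁` at `±(0,0,1)`, `∓(i/2)e₂` at `±(2,0,0)`, `∓(i/2)e₃` at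
`±(0,3,0)`); the class `Λ₂₃ = {c : c_k = 0 unless 2 ∣ k₀ ∧ 3 ∣ k₁}` (the symmetry class of the Stokes state, invariant, the
class of the kit continuation); `F_N(E) := {(c,ν) : c ∈ galerkinSubspace (modes N) ∩ Λ₂₃, 0 < ν, galerkinRHS (modes N) ν C₁₂₃ c = 0,
Σ‖c_k‖² ≤ E}`; and its LAMINAR PART `Lam_N(E) := {z ∈ F_N(E) : the connected component of z IN F_N(E) reaches arbitrarily
large viscosity}` — the in-tree notion `LaminarNeverLoud.Negative.laminarSet`, here taken INSIDE the energy ball (the Stokes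
states `≈ (νA)⁻¹C₁₂₃` have energy `→ 0` as `ν → ∞`, so the Stokes branch lies in every `F_N(E)`, `E > 0`).  No anchor point, no
uniqueness threshold and no explicit laminar formula are needed (f₁₂₃ has none: its Stokes state is not Euler-steady).

STUBS (both crux-sized, structurally different, neither the crux; probes `→ X`, `→ AnomalousDissipation` fail, folder `bc/`):
* `stub_reachF123` (R, TOPOLOGY / global continuation): `∃ E ∀ ν₁ > 0 ∃ᶠ N`, `Lam_N(E)` contains a state with `ν ≤ ν₁` — the
  bounded Stokes continuum reaches zero viscosity at infinitely many resolutions.  No loudness asserted.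
* `stub_loudF123` (L, ESTIMATE / non-depletion): `∀ E ∃ ν₁ ε κ N₁ ∀ N ≥ N₁`, every state of `Lam_N(E)` with `κ/N² ≤ ν ≤ ν₁` has
  `ν·4π²Σ|k|²‖c_k‖² ≥ ε` — the bounded Stokes continuum stays loud in the resolved window.  No existence asserted.
COMPOSITION `GalerkinSteadyZerothLaw_of : GalerkinSteadyZerothLaw` from the two stubs (kernel-checked, no `sorry` outside them):
`ν_j := ν₁/(j+2)`; per `j`, R at threshold `ν_j` frequently in `N`, intersected with the eventual `N ≥ N₁`, `κ/N² ≤ ν_j`; the laminar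
state `z` (height `≤ ν_j`) and a point `z'` of its component at height `≥ ν_j` give, by the IVT on the viscosity projection of the
preconnected component, a state `w` of the SAME component at height exactly `ν_j` — laminar again (`connectedComponentIn_eq`),
steady, `energy ≤ E`, in the window, hence loud by L; the landed dictionary (`fieldOf`, `steadyState_fieldOf`, Parseval,
`crux_iff`) turns it into an admissible tested-form state of the field `f₁₂₃ = fieldOf 3 C₁₂₃`.

Disproof used (`Disproof.lean` cycles 1–2, NO KILL): §3 load-bearing conjunction — bounded ∧ `ν → 0` in R, loud in L, `E`
uniform = R's single `E`; §4 dimension — f₁₂₃ depends on all three coordinates with all three components, so no state of the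
class is planar or x₃-invariant unless trivial (the Alexakis–Doering / TwohalfdNeg mechanisms do not apply); §5 `not_crux_iff` —
¬L is a laminarisation theorem ALONG THE BOUNDED STOKES CONTINUUM of f₁₂₃ (cdisprove target: one quiet bounded state of f₁₂₃ at
`ν ≫ N⁻²` Stokes-connected within bounded energy, infinitely many `N`).  `-- Targets`: none.  Negatives index (14324, 0204, 13037,
2979, 2984, 2859): no instance relation with R or L.
-/

noncomputable section

-- `Summit.<Summit>.<Problem>` is the tree's mandated summit-side namespace (CONVENTIONS §2); deliberate duplicate.
set_option linter.dupNamespace false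

open scoped InnerProductSpace Topology
open MeasureTheory Filter Set UnitAddTorus
open Literature.Analysis.FunctionSpaces Literature.Analysis.FunctionSpaces.Torus
open Literature.Analysis.FluidPDE Literature.Analysis.FluidPDE.Torus

namespace Summit.AnomalousDissipation.AnomalousDissipation.Cruxes.GalerkinSteadyZerothLaw.StokesContinuumF123

open Summit.AnomalousDissipation.AnomalousDissipation.Theses.MirrorVariety (GalerkinSteadyZerothLaw)
open Summit.AnomalousDissipation.AnomalousDissipation.Theorems.GalerkinSteadyZerothLaw.Negative
  (SteadyState BandLimited FrequentlyLoud LoudWitness crux_iff fieldOf steadyState_fieldOf integral_norm_sq_fieldOf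
    loudness_fieldOf)
open Summit.AnomalousDissipation.AnomalousDissipation.Theorems.LaminarNeverLoud.Negative
  (modes forceCoeff energy dissipation modes_symm zero_not_mem_modes)

/-! ## §1 The force `f₁₂₃ = (sin 2πx₃, sin 4πx₁, sin 6πx₂)` in Fourier coordinates -/

/-- The `x₃`-shell `{(0,0,±1)}` (carries `sin 2πx₃ · e₁`). -/
def shellA : Finset (Fin 3 → ℤ) := Fintype.piFinset ![({0} : Finset ℤ), {0}, {1, -1}]

/-- The `x₁`-shell `{(±2,0,0)}` (carries `sin 4πx₁ · e₂`). -/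
def shellB : Finset (Fin 3 → ℤ) := Fintype.piFinset ![({2, -2} : Finset ℤ), {0}, {0}]

/-- The `x₂`-shell `{(0,±3,0)}` (carries `sin 6πx₂ · e₃`). -/
def shellC : Finset (Fin 3 → ℤ) := Fintype.piFinset ![({0} : Finset ℤ), {3, -3}, {0}]

/-- The Fourier coefficients `C₁₂₃` of `f₁₂₃(x) = (sin 2πx₃, sin 4πx₁, sin 6πx₂)` (`f = Σ_k C(k) e^{2πik·x}`, `sin θ = (e^{iθ} −
e^{−iθ})/2i`): `−(i l₂/2) e₁` on `{(0,0,±1)}`, `−(i l₀/4) e₂` on `{(±2,0,0)}`, `−(i l₁/6) e₃` on `{(0,±3,0)}`, zero elsewhere. -/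
def f123Coeff (l : Fin 3 → ℤ) : EuclideanSpace ℂ (Fin 3) :=
  if l ∈ shellA then (-(Complex.I * (l 2 : ℂ)) / 2) • !₂[(1 : ℂ), 0, 0]
  else if l ∈ shellB then (-(Complex.I * (l 0 : ℂ)) / 4) • !₂[(0 : ℂ), 1, 0]
  else if l ∈ shellC then (-(Complex.I * (l 1 : ℂ)) / 6) • !₂[(0 : ℂ), 0, 1]
  else 0

/-- `f123Coeff` is, definitionally, the explicit lambda written into the two registered stubs. [folklore] -/
theorem f123Coeff_eq_lambda : f123Coeff = (fun l : Fin 3 → ℤ =>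
    if l ∈ Fintype.piFinset ![({0} : Finset ℤ), {0}, {1, -1}] then (-(Complex.I * (l 2 : ℂ)) / 2) • !₂[(1 : ℂ), 0, 0]
    else if l ∈ Fintype.piFinset ![({2, -2} : Finset ℤ), {0}, {0}] then (-(Complex.I * (l 0 : ℂ)) / 4) • !₂[(0 : ℂ), 1, 0]
    else if l ∈ Fintype.piFinset ![({0} : Finset ℤ), {3, -3}, {0}] then (-(Complex.I * (l 1 : ℂ)) / 6) • !₂[(0 : ℂ), 0, 1]
    else 0) := rfl

/-- Membership in the `x₃`-shell, coordinatewise. [folklore] -/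
theorem mem_shellA_iff (l : Fin 3 → ℤ) : l ∈ shellA ↔ l 0 = 0 ∧ l 1 = 0 ∧ (l 2 = 1 ∨ l 2 = -1) := by
  rw [shellA, Fintype.mem_piFinset, Fin.forall_fin_succ, Fin.forall_fin_two]
  simp

/-- Membership in the `x₁`-shell, coordinatewise. [folklore] -/
theorem mem_shellB_iff (l : Fin 3 → ℤ) : l ∈ shellB ↔ (l 0 = 2 ∨ l 0 = -2) ∧ l 1 = 0 ∧ l 2 = 0 := by
  rw [shellB, Fintype.mem_piFinset, Fin.forall_fin_succ, Fin.forall_fin_two]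
  simp

/-- Membership in the `x₂`-shell, coordinatewise. [folklore] -/
theorem mem_shellC_iff (l : Fin 3 → ℤ) : l ∈ shellC ↔ l 0 = 0 ∧ (l 1 = 3 ∨ l 1 = -3) ∧ l 2 = 0 := by
  rw [shellC, Fintype.mem_piFinset, Fin.forall_fin_succ, Fin.forall_fin_two]
  simp

/-- The `x₁`-shell misses the `x₃`-shell. [folklore] -/
theorem not_memA_of_memB {l : Fin 3 → ℤ} (h : l ∈ shellB) : l ∉ shellA := by
  rw [mem_shellB_iff] at h
  rw [mem_shellA_iff]
  omega

/-- The `x₂`-shell misses the `x₃`-shell. [folklore] -/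
theorem not_memA_of_memC {l : Fin 3 → ℤ} (h : l ∈ shellC) : l ∉ shellA := by
  rw [mem_shellC_iff] at h
  rw [mem_shellA_iff]
  omega

/-- The `x₂`-shell misses the `x₁`-shell. [folklore] -/
theorem not_memB_of_memC {l : Fin 3 → ℤ} (h : l ∈ shellC) : l ∉ shellB := by
  rw [mem_shellC_iff] at h
  rw [mem_shellB_iff]
  omega

/-- The three shells are symmetric under `l ↦ −l`. [folklore] -/
theorem neg_mem_shellA {l : Fin 3 → ℤ} (h : l ∈ shellA) : -l ∈ shellA := by
  rw [mem_shellA_iff] at h ⊢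
  simp only [Pi.neg_apply, neg_eq_iff_eq_neg, neg_neg]
  omega

theorem neg_mem_shellB {l : Fin 3 → ℤ} (h : l ∈ shellB) : -l ∈ shellB := by
  rw [mem_shellB_iff] at h ⊢
  simp only [Pi.neg_apply, neg_eq_iff_eq_neg, neg_neg]
  omega

theorem neg_mem_shellC {l : Fin 3 → ℤ} (h : l ∈ shellC) : -l ∈ shellC := by
  rw [mem_shellC_iff] at h ⊢
  simp only [Pi.neg_apply, neg_eq_iff_eq_neg, neg_neg]
  omega

/-- Values of `C₁₂₃` on the three shells and off them. [folklore] -/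
theorem f123Coeff_of_memA {l : Fin 3 → ℤ} (h : l ∈ shellA) :
    f123Coeff l = (-(Complex.I * (l 2 : ℂ)) / 2) • !₂[(1 : ℂ), 0, 0] := by
  rw [f123Coeff, if_pos h]

theorem f123Coeff_of_memB {l : Fin 3 → ℤ} (h : l ∈ shellB) :
    f123Coeff l = (-(Complex.I * (l 0 : ℂ)) / 4) • !₂[(0 : ℂ), 1, 0] := by
  rw [f123Coeff, if_neg (not_memA_of_memB h), if_pos h]

theorem f123Coeff_of_memC {l : Fin 3 → ℤ} (h : l ∈ shellC) :
    f123Coeff l = (-(Complex.I * (l 1 : ℂ)) / 6) • !₂[(0 : ℂ), 0, 1] := by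
  rw [f123Coeff, if_neg (not_memA_of_memC h), if_neg (not_memB_of_memC h), if_pos h]

theorem f123Coeff_of_not_mem {l : Fin 3 → ℤ} (hA : l ∉ shellA) (hB : l ∉ shellB) (hC : l ∉ shellC) :
    f123Coeff l = 0 := by
  rw [f123Coeff, if_neg hA, if_neg hB, if_neg hC]

/-- Shell vectors are nonzero with `|l|² ≤ 9`. [folklore] -/
theorem ne_zero_and_freqNormSq_le {l : Fin 3 → ℤ} (h : l ∈ shellA ∨ l ∈ shellB ∨ l ∈ shellC) :
    l ≠ 0 ∧ freqNormSq l ≤ 9 := by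
  unfold freqNormSq
  simp only [Fin.sum_univ_three]
  rcases h with h | h | h
  · rw [mem_shellA_iff] at h
    obtain ⟨h0, h1, h2⟩ := h
    refine ⟨fun hl => ?_, ?_⟩
    · have := congrFun hl 2
      simp only [Pi.zero_apply] at this
      omega
    · rcases h2 with h2 | h2 <;> simp [h0, h1, h2]
  · rw [mem_shellB_iff] at h
    obtain ⟨h0, h1, h2⟩ := h
    refine ⟨fun hl => ?_, ?_⟩
    · have := congrFun hl 0
      simp only [Pi.zero_apply] at this
      omega
    · rcases h0 with h0 | h0 <;> simp [h0, h1, h2] <;> norm_num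
  · rw [mem_shellC_iff] at h
    obtain ⟨h0, h1, h2⟩ := h
    refine ⟨fun hl => ?_, ?_⟩
    · have := congrFun hl 1
      simp only [Pi.zero_apply] at this
      omega
    · rcases h1 with h1 | h1 <;> simp [h0, h1, h2] <;> norm_num

/-- The support of `C₁₂₃` lies in the punctured ball of radius `3`. [folklore] -/
theorem mem_modes_three {l : Fin 3 → ℤ} (h : l ∈ shellA ∨ l ∈ shellB ∨ l ∈ shellC) : l ∈ modes (Fin 3) 3 := by
  obtain ⟨h0, hn⟩ := ne_zero_and_freqNormSq_le h
  rw [Finset.mem_erase, mem_freqBall]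
  exact ⟨h0, by norm_num; exact hn⟩

/-- Off `modes 3` the coefficients vanish. [folklore] -/
theorem f123Coeff_eq_zero_of_not_mem_modes {l : Fin 3 → ℤ} (hl : l ∉ modes (Fin 3) 3) : f123Coeff l = 0 :=
  f123Coeff_of_not_mem (fun h => hl (mem_modes_three (Or.inl h))) (fun h => hl (mem_modes_three (Or.inr (Or.inl h))))
    (fun h => hl (mem_modes_three (Or.inr (Or.inr h))))

/-- `C₁₂₃` satisfies the reality condition `C(−l) = conj C(l)`. [folklore] -/
theorem isConjSymm_f123Coeff : IsConjSymm f123Coeff := by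
  intro l
  by_cases hA : l ∈ shellA
  · rw [f123Coeff_of_memA hA, f123Coeff_of_memA (neg_mem_shellA hA), EuclideanSpace.conjVec_smul]
    have hconj : starRingEnd ℂ (-(Complex.I * (l 2 : ℂ)) / 2) = -(Complex.I * ((-l) 2 : ℂ)) / 2 := by
      rw [map_div₀, map_neg, map_mul, Complex.conj_I, map_intCast, map_ofNat, Pi.neg_apply, Int.cast_neg]
      ring
    rw [hconj]
    congr 1
    ext i
    fin_cases i <;> simp [EuclideanSpace.conjVec_apply]
  by_cases hB : l ∈ shellB
  · rw [f123Coeff_of_memB hB, f123Coeff_of_memB (neg_mem_shellB hB), EuclideanSpace.conjVec_smul]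
    have hconj : starRingEnd ℂ (-(Complex.I * (l 0 : ℂ)) / 4) = -(Complex.I * ((-l) 0 : ℂ)) / 4 := by
      rw [map_div₀, map_neg, map_mul, Complex.conj_I, map_intCast, map_ofNat, Pi.neg_apply, Int.cast_neg]
      ring
    rw [hconj]
    congr 1
    ext i
    fin_cases i <;> simp [EuclideanSpace.conjVec_apply]
  by_cases hC : l ∈ shellC
  · rw [f123Coeff_of_memC hC, f123Coeff_of_memC (neg_mem_shellC hC), EuclideanSpace.conjVec_smul]
    have hconj : starRingEnd ℂ (-(Complex.I * (l 1 : ℂ)) / 6) = -(Complex.I * ((-l) 1 : ℂ)) / 6 := by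
      rw [map_div₀, map_neg, map_mul, Complex.conj_I, map_intCast, map_ofNat, Pi.neg_apply, Int.cast_neg]
      ring
    rw [hconj]
    congr 1
    ext i
    fin_cases i <;> simp [EuclideanSpace.conjVec_apply]
  · have hnA : -l ∉ shellA := fun h => hA (by simpa using neg_mem_shellA h)
    have hnB : -l ∉ shellB := fun h => hB (by simpa using neg_mem_shellB h)
    have hnC : -l ∉ shellC := fun h => hC (by simpa using neg_mem_shellC h)
    rw [f123Coeff_of_not_mem hA hB hC, f123Coeff_of_not_mem hnA hnB hnC, EuclideanSpace.conjVec_zero]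

/-- `C₁₂₃` is transversal: `l · C(l) = 0` (each mode is polarised orthogonally to its wavevector). [folklore] -/
theorem f123Coeff_transversal (l : Fin 3 → ℤ) : ∑ j, ((l j : ℤ) : ℂ) * f123Coeff l j = 0 := by
  by_cases hA : l ∈ shellA
  · have h0 : l 0 = 0 := ((mem_shellA_iff l).1 hA).1
    rw [f123Coeff_of_memA hA]
    simp [Fin.sum_univ_three, PiLp.smul_apply, h0]
  by_cases hB : l ∈ shellB
  · have h1 : l 1 = 0 := ((mem_shellB_iff l).1 hB).2.1
    rw [f123Coeff_of_memB hB]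
    simp [Fin.sum_univ_three, PiLp.smul_apply, h1]
  by_cases hC : l ∈ shellC
  · have h2 : l 2 = 0 := ((mem_shellC_iff l).1 hC).2.2
    rw [f123Coeff_of_memC hC]
    simp [Fin.sum_univ_three, PiLp.smul_apply, h2]
  · rw [f123Coeff_of_not_mem hA hB hC]
    simp

/-- At every level the restriction of `C₁₂₃` is a real solenoidal coefficient vector. [folklore] -/
theorem f123Coeff_mem_galerkinSubspace (N : ℕ) :
    (fun k : ↥(modes (Fin 3) N) => f123Coeff k) ∈ galerkinSubspace (modes (Fin 3) N) :=
  ⟨isRealCoeff_restrict isConjSymm_f123Coeff, fun k => f123Coeff_transversal k⟩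

/-- The zero-extension of the level-`3` vector is the whole family `C₁₂₃` (support in `modes 3`). [folklore] -/
theorem coeffExt_f123_three :
    coeffExt (modes (Fin 3) 3) (fun k : ↥(modes (Fin 3) 3) => f123Coeff k) = f123Coeff := by
  funext k
  by_cases hk : k ∈ modes (Fin 3) 3
  · rw [coeffExt_of_mem _ hk]
  · rw [coeffExt_of_not_mem _ hk, f123Coeff_eq_zero_of_not_mem_modes hk]

/-- **The force field `f₁₂₃`.**  `f₁₂₃ := fieldOf 3 (C₁₂₃|modes 3)` is smooth, divergence free, mean zero, square integrable,
and its Fourier force vector at EVERY level `N` is `C₁₂₃` read on `modes N` (`mFourierCoeff_realTrigPoly` + `coeffExt_f123_three`).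
[folklore] -/
theorem f123Force_admissible :
    IsSmooth (fieldOf 3 (fun k : ↥(modes (Fin 3) 3) => f123Coeff k)) ∧
    IsDivFree (fieldOf 3 (fun k : ↥(modes (Fin 3) 3) => f123Coeff k)) ∧
    HasZeroMean (fieldOf 3 (fun k : ↥(modes (Fin 3) 3) => f123Coeff k)) ∧
    MemLp (fieldOf 3 (fun k : ↥(modes (Fin 3) 3) => f123Coeff k)) 2 volume ∧
    ∀ N : ℕ, forceCoeff (modes (Fin 3) N) (fieldOf 3 (fun k : ↥(modes (Fin 3) 3) => f123Coeff k)) =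
      fun k : ↥(modes (Fin 3) N) => f123Coeff k := by
  have hC₃ : (fun k : ↥(modes (Fin 3) 3) => f123Coeff k) ∈ galerkinSubspace (modes (Fin 3) 3) :=
    f123Coeff_mem_galerkinSubspace 3
  have hS : ∀ k ∈ modes (Fin 3) 3, -k ∈ modes (Fin 3) 3 := modes_symm 3
  have hS0 : (0 : Fin 3 → ℤ) ∉ modes (Fin 3) 3 := zero_not_mem_modes 3
  have hCsymm : IsConjSymm (coeffExt (modes (Fin 3) 3) (fun k : ↥(modes (Fin 3) 3) => f123Coeff k)) :=
    hC₃.1.isConjSymm_coeffExt hS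
  have hCT : IsTransversal (modes (Fin 3) 3) (coeffExt (modes (Fin 3) 3) (fun k : ↥(modes (Fin 3) 3) => f123Coeff k)) :=
    hC₃.2.isTransversal_coeffExt
  have hfs : IsSmooth (fieldOf 3 (fun k : ↥(modes (Fin 3) 3) => f123Coeff k)) := isSmooth_realTrigPoly _ _
  refine ⟨hfs, isDivFree_realTrigPoly hCT, hasZeroMean_realTrigPoly_of_zero_not_mem hS0 _,
    hfs.continuous.memLp_of_hasCompactSupport (HasCompactSupport.of_compactSpace _), fun N => ?_⟩
  funext k
  show mFourierCoeff (EuclideanSpace.complexify ∘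
      realTrigPoly (modes (Fin 3) 3) (coeffExt (modes (Fin 3) 3) (fun k : ↥(modes (Fin 3) 3) => f123Coeff k)))
      (k : Fin 3 → ℤ) = f123Coeff k
  rw [mFourierCoeff_realTrigPoly hS hCsymm, coeffExt_f123_three]
  split_ifs with hk
  · rfl
  · exact (f123Coeff_eq_zero_of_not_mem_modes hk).symm

/-! ## §2 The intermediate value step on a connected component -/

/-- **IVT on the viscosity projection of a connected component.**  If the component of `x₀` in `F ⊆ X × ℝ` contains a
point `z` with `x₀.2 ≤ a ≤ z.2`, it contains a point with second coordinate EXACTLY `a` (the continuous image of a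
preconnected set in `ℝ` is order-connected). [folklore] -/
theorem exists_mem_connectedComponentIn_snd_eq {X : Type*} [TopologicalSpace X] {F : Set (X × ℝ)} {x₀ z : X × ℝ}
    (hz : z ∈ connectedComponentIn F x₀) {a : ℝ} (hxa : x₀.2 ≤ a) (haz : a ≤ z.2) :
    ∃ w ∈ connectedComponentIn F x₀, w.2 = a := by
  have hx₀F : x₀ ∈ F := by
    by_contra h
    rw [connectedComponentIn_eq_empty h] at hz
    exact hz
  have hx₀ : x₀ ∈ connectedComponentIn F x₀ := mem_connectedComponentIn hx₀F
  have hpre : IsPreconnected (Prod.snd '' connectedComponentIn F x₀) :=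
    isPreconnected_connectedComponentIn.image _ continuous_snd.continuousOn
  have hsub := hpre.Icc_subset (mem_image_of_mem Prod.snd hx₀) (mem_image_of_mem Prod.snd hz)
  obtain ⟨w, hw, hwa⟩ := hsub ⟨hxa, haz⟩
  exact ⟨w, hw, hwa⟩

/-! ## §3 Registered stubs -/

/-- **stub_reachF123** (R; crux-sized; TOPOLOGY / global continuation): for the force `f₁₂₃`, with ONE energy budget `E`, the
LAMINAR PART of the bounded `Λ₂₃`-symmetric steady Galerkin set — the states whose connected component INSIDE the energy ball
reaches arbitrarily large viscosity, i.e. the bounded Stokes continuum — reaches arbitrarily small viscosity at infinitely many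
resolutions.  No loudness asserted.  Evidence: kit j019660/j020781 (13038-c1): the Stokes-connected branch, `Λ₂₃` class, continued
without fold from `ν = 0.2` to `ν = 0.0021` with `E ≤ 1.13` (`K ≤ 24`, tails `≤ 3e-8`). -/
theorem stub_reachF123 : ∀ C : (Fin 3 → ℤ) → EuclideanSpace ℂ (Fin 3), C = (fun l : Fin 3 → ℤ => if l ∈ Fintype.piFinset ![({0} : Finset ℤ), {0}, {1, -1}] then (-(Complex.I * (l 2 : ℂ)) / 2) • !₂[(1 : ℂ), 0, 0] else if l ∈ Fintype.piFinset ![({2, -2} : Finset ℤ), {0}, {0}] then (-(Complex.I * (l 0 : ℂ)) / 4) • !₂[(0 : ℂ), 1, 0] else if l ∈ Fintype.piFinset ![({0} : Finset ℤ), {3, -3}, {0}] then (-(Complex.I * (l 1 : ℂ)) / 6) • !₂[(0 : ℂ), 0, 1] else 0) → ∃ E : ℝ, ∀ ν₁ : ℝ, 0 < ν₁ → ∃ᶠ N in Filter.atTop, ∀ S : Finset (Fin 3 → ℤ), S = (Literature.Analysis.FunctionSpaces.Torus.freqBall N).erase (0 : Fin 3 → ℤ) → ∀ F : Set ((↥S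 → EuclideanSpace ℂ (Fin 3)) × ℝ), F = {z | z.1 ∈ Literature.Analysis.FluidPDE.galerkinSubspace S ∧ (∀ k : ↥S, ¬ ((2 : ℤ) ∣ (k : Fin 3 → ℤ) 0 ∧ (3 : ℤ) ∣ (k : Fin 3 → ℤ) 1) → z.1 k = 0) ∧ 0 < z.2 ∧ Literature.Analysis.FluidPDE.galerkinRHS S z.2 (fun k : ↥S => C k) z.1 = 0 ∧ ∑ k : ↥S, ‖z.1 k‖ ^ 2 ≤ E} → ∃ z ∈ F, (∀ Λ : ℝ, ∃ z' ∈ connectedComponentIn F z, Λ ≤ z'.2) ∧ z.2 ≤ ν₁ := by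
  sorry

/-- **stub_loudF123** (L; crux-sized; ESTIMATE / non-depletion): for the force `f₁₂₃` and every energy budget `E` there are
`ν₁, ε, κ, N₁` such that for `N ≥ N₁` every state of the laminar part of the bounded `Λ₂₃`-symmetric steady Galerkin set lying
in the resolved window `κ/N² ≤ ν ≤ ν₁` dissipates at least `ε`.  No existence asserted (vacuous where the Stokes continuum does
not reach).  Evidence: along the j019660 branch `D = ν‖∇u‖² ∈ [0.61, 0.86]` for `ν ∈ [0.002, 0.03]`, decline arrested and reversed;
three-code eddy-resolved confirmation to `ν = 0.004` (13038-c2). -/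
theorem stub_loudF123 : ∀ C : (Fin 3 → ℤ) → EuclideanSpace ℂ (Fin 3), C = (fun l : Fin 3 → ℤ => if l ∈ Fintype.piFinset ![({0} : Finset ℤ), {0}, {1, -1}] then (-(Complex.I * (l 2 : ℂ)) / 2) • !₂[(1 : ℂ), 0, 0] else if l ∈ Fintype.piFinset ![({2, -2} : Finset ℤ), {0}, {0}] then (-(Complex.I * (l 0 : ℂ)) / 4) • !₂[(0 : ℂ), 1, 0] else if l ∈ Fintype.piFinset ![({0} : Finset ℤ), {3, -3}, {0}] then (-(Complex.I * (l 1 : ℂ)) / 6) • !₂[(0 : ℂ), 0, 1] else 0) → ∀ E : ℝ, ∃ ν₁ ε κ : ℝ, 0 < ν₁ ∧ 0 < ε ∧ ∃ N₁ : ℕ, ∀ N : ℕ, N₁ ≤ N → ∀ S : Finset (Fin 3 → ℤ), S = (Literature.Analysis.FunctionSpaces.Torus.freqBall N).erase (0 : Fin 3 → ℤ) → ∀ F : Set ((↥S → EuclideanSpace ℂ (Fin 3)) × ℝ), F = {z | z.1 ∈ Literature.Analysis.FluidPDE.galerkinSubspace S ∧ (∀ k : ↥S, ¬ ((2 : ℤ)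 ∣ (k : Fin 3 → ℤ) 0 ∧ (3 : ℤ) ∣ (k : Fin 3 → ℤ) 1) → z.1 k = 0) ∧ 0 < z.2 ∧ Literature.Analysis.FluidPDE.galerkinRHS S z.2 (fun k : ↥S => C k) z.1 = 0 ∧ ∑ k : ↥S, ‖z.1 k‖ ^ 2 ≤ E} → ∀ z ∈ F, (∀ Λ : ℝ, ∃ z' ∈ connectedComponentIn F z, Λ ≤ z'.2) → κ / (N : ℝ) ^ 2 ≤ z.2 → z.2 ≤ ν₁ → ε ≤ z.2 * (4 * Real.pi ^ 2 * ∑ k : ↥S, Literature.Analysis.FunctionSpaces.Torus.freqNormSq (k : Fin 3 → ℤ) * ‖z.1 k‖ ^ 2) := by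
  sorry

/-! ## §4 The assembly (hypothesis form) and the composition BY NAME (kernel-checked, no sorry outside the stubs) -/

/-- **A loud witness from the two pieces** (hypotheses = the stub statements verbatim, so that a future route split
`StokesContinuumReachesZeroF123 → StokesContinuumStaysLoudF123 → GalerkinSteadyZerothLaw` is this theorem by `δ`-unfolding).
Proof: instantiate both at `C₁₂₃` (`rfl`); `E` from R; `ν₁, ε, κ, N₁` from L at `E`; `ν_j := ν₁/(j+2) → 0⁺`, the SAME for every
resolution.  Per `j`: R at threshold `ν_j` holds frequently in `N`; intersect with the eventual `N ≥ N₁`, `κ/N² ≤ ν_j`; the laminar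
state `z` has height `≤ ν_j` and its component contains a point at height `≥ ν_j`, so by the IVT the component meets the slice
`ν = ν_j` at a state `w`, laminar again (`connectedComponentIn_eq`), real solenoidal, a zero of the `f₁₂₃`-forced Galerkin field,
`energy ≤ E`, in the window, hence LOUD by L; the dictionary `fieldOf` / `steadyState_fieldOf` / Parseval closes. [folklore] -/
theorem loudWitness_of_subs
    (hR : ∀ C : (Fin 3 → ℤ) → EuclideanSpace ℂ (Fin 3), C = (fun l : Fin 3 → ℤ => if l ∈ Fintype.piFinset ![({0} : Finset ℤ), {0}, {1, -1}] then (-(Complex.I * (l 2 : ℂ)) / 2) • !₂[(1 : ℂ), 0, 0] else if l ∈ Fintype.piFinset ![({2, -2} : Finset ℤ), {0}, {0}] then (-(Complex.I * (l 0 : ℂ)) / 4) • !₂[(0 : ℂ), 1, 0] else if l ∈ Fintype.piFinset ![({0} : Finset ℤ), {3, -3}, {0}] then (-(Complex.I * (l 1 : ℂ)) / 6) • !₂[(0 : ℂ), 0, 1] else 0) → ∃ E : ℝ, ∀ ν₁ : ℝ, 0 < ν₁ → ∃ᶠ N in Filter.atTop, ∀ S : Finset (Fin 3 → ℤ), S =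 (Literature.Analysis.FunctionSpaces.Torus.freqBall N).erase (0 : Fin 3 → ℤ) → ∀ F : Set ((↥S → EuclideanSpace ℂ (Fin 3)) × ℝ), F = {z | z.1 ∈ Literature.Analysis.FluidPDE.galerkinSubspace S ∧ (∀ k : ↥S, ¬ ((2 : ℤ) ∣ (k : Fin 3 → ℤ) 0 ∧ (3 : ℤ) ∣ (k : Fin 3 → ℤ) 1) → z.1 k = 0) ∧ 0 < z.2 ∧ Literature.Analysis.FluidPDE.galerkinRHS S z.2 (fun k : ↥S => C k) z.1 = 0 ∧ ∑ k : ↥S, ‖z.1 k‖ ^ 2 ≤ E} → ∃ z ∈ F, (∀ Λ : ℝ, ∃ z' ∈ connectedComponentIn F z, Λ ≤ z'.2) ∧ z.2 ≤ ν₁)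
    (hL : ∀ C : (Fin 3 → ℤ) → EuclideanSpace ℂ (Fin 3), C = (fun l : Fin 3 → ℤ => if l ∈ Fintype.piFinset ![({0} : Finset ℤ), {0}, {1, -1}] then (-(Complex.I * (l 2 : ℂ)) / 2) • !₂[(1 : ℂ), 0, 0] else if l ∈ Fintype.piFinset ![({2, -2} : Finset ℤ), {0}, {0}] then (-(Complex.I * (l 0 : ℂ)) / 4) • !₂[(0 : ℂ), 1, 0] else if l ∈ Fintype.piFinset ![({0} : Finset ℤ), {3, -3}, {0}] then (-(Complex.I * (l 1 : ℂ)) / 6) • !₂[(0 : ℂ), 0, 1] else 0) → ∀ E : ℝ, ∃ ν₁ ε κ : ℝ, 0 < ν₁ ∧ 0 < ε ∧ ∃ N₁ : ℕ, ∀ N : ℕ, N₁ ≤ N → ∀ S : Finset (Fin 3 → ℤ), S = (Literature.Analysis.FunctionSpaces.Torus.freqBall N).erase (0 : Fin 3 → ℤ) → ∀ F : Set ((↥S → EuclideanSpace ℂ (Fin 3)) × ℝ), F = {z | z.1 ∈ Literature.Analysis.FluidPDE.galerkinSubspace S ∧ (∀ k : ↥S, ¬ ((2 : ℤ) ∣ (k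 : Fin 3 → ℤ) 0 ∧ (3 : ℤ) ∣ (k : Fin 3 → ℤ) 1) → z.1 k = 0) ∧ 0 < z.2 ∧ Literature.Analysis.FluidPDE.galerkinRHS S z.2 (fun k : ↥S => C k) z.1 = 0 ∧ ∑ k : ↥S, ‖z.1 k‖ ^ 2 ≤ E} → ∀ z ∈ F, (∀ Λ : ℝ, ∃ z' ∈ connectedComponentIn F z, Λ ≤ z'.2) → κ / (N : ℝ) ^ 2 ≤ z.2 → z.2 ≤ ν₁ → ε ≤ z.2 * (4 * Real.pi ^ 2 * ∑ k : ↥S, Literature.Analysis.FunctionSpaces.Torus.freqNormSq (k : Fin 3 → ℤ) * ‖z.1 k‖ ^ 2)) :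
    ∃ f : UnitAddTorus (Fin 3) → EuclideanSpace ℝ (Fin 3), IsSmooth f ∧ IsDivFree f ∧ HasZeroMean f ∧ LoudWitness f := by
  -- both pieces at the family `C₁₂₃`
  obtain ⟨E, hreach⟩ := hR f123Coeff f123Coeff_eq_lambda
  obtain ⟨ν₁, ε, κ, hν₁, hε, N₁, hloud⟩ := hL f123Coeff f123Coeff_eq_lambda E
  obtain ⟨hfs, hfd, hfm, hfmem, hfcoeff⟩ := f123Force_admissible
  -- the crux's viscosity sequence, the same for every resolution
  set ν : ℕ → ℝ := fun j => ν₁ / ((j : ℝ) + 2) with hνdef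
  have hνpos : ∀ j, 0 < ν j := fun j => by positivity
  have hνle : ∀ j, ν j ≤ ν₁ := fun j => by
    have h2 : (1 : ℝ) ≤ (j : ℝ) + 2 := by
      have : (0 : ℝ) ≤ j := Nat.cast_nonneg j
      linarith
    exact div_le_self hν₁.le h2
  have hνlim : Tendsto ν atTop (𝓝 0) := by
    have h1 : Tendsto (fun j : ℕ => (j : ℝ) + 2) atTop atTop :=
      tendsto_natCast_atTop_atTop.atTop_add tendsto_const_nhds
    exact tendsto_const_nhds.div_atTop h1
  refine ⟨fieldOf 3 (fun k : ↥(modes (Fin 3) 3) => f123Coeff k), hfs, hfd, hfm, ν, E, ε, hνpos, hνlim, hε,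
    fun j => ?_⟩
  -- eventual side conditions on the resolution
  have hκ : ∀ᶠ N : ℕ in atTop, κ / (N : ℝ) ^ 2 ≤ ν j := by
    have hsq : Tendsto (fun N : ℕ => (N : ℝ) ^ 2) atTop atTop :=
      (tendsto_pow_atTop two_ne_zero).comp tendsto_natCast_atTop_atTop
    have h0 : Tendsto (fun N : ℕ => κ / (N : ℝ) ^ 2) atTop (𝓝 0) := tendsto_const_nhds.div_atTop hsq
    exact h0.eventually (Iic_mem_nhds (hνpos j))
  have hev : ∀ᶠ N : ℕ in atTop, N₁ ≤ N ∧ κ / (N : ℝ) ^ 2 ≤ ν j := (eventually_ge_atTop N₁).and hκ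
  refine ((hreach (ν j) (hνpos j)).and_eventually hev).mono ?_
  rintro N ⟨hN, hN₁, hκN⟩
  obtain ⟨z, hzF, hzlam, hzle⟩ := hN _ rfl _ rfl
  -- the component of `z` reaches height `ν j` from above …
  obtain ⟨z', hz'C, hz'ge⟩ := hzlam (ν j)
  -- … so by the IVT it meets the slice `ν = ν j`
  obtain ⟨w, hwC, hw2⟩ := exists_mem_connectedComponentIn_snd_eq hz'C hzle hz'ge
  have hwF := connectedComponentIn_subset _ _ hwC
  -- `w` is laminar as well (same component)
  have hwlam : ∀ Λ : ℝ, ∃ z'' ∈ connectedComponentIn _ w, Λ ≤ z''.2 := fun Λ => by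
    obtain ⟨y, hy, hyΛ⟩ := hzlam Λ
    exact ⟨y, (connectedComponentIn_eq hwC) ▸ hy, hyΛ⟩
  -- non-depletion on the slice, in the resolved window
  have hwloud := hloud N hN₁ _ rfl _ rfl w hwF hwlam (by rw [hw2]; exact hκN) (by rw [hw2]; exact hνle j)
  simp only [Set.mem_setOf_eq] at hwF
  obtain ⟨hwV, -, -, hw0, hwE⟩ := hwF
  rw [hw2] at hw0 hwloud
  -- the dictionary: coefficient state ↦ admissible tested-form field of `f₁₂₃`
  refine ⟨fieldOf N w.1, steadyState_fieldOf hfmem hwV ?_, ?_, ?_⟩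
  · rw [hfcoeff N]
    exact hw0
  · rw [integral_norm_sq_fieldOf hwV]
    exact hwE
  · rw [loudness_fieldOf (ν j) hwV]
    exact hwloud

/-- **Composition of the line** (kernel-checked, no `sorry` outside the two stubs; concludes the route decl BY NAME):
the registered stubs `stub_reachF123`, `stub_loudF123` feed `loudWitness_of_subs`, and the landed `crux_iff` (`Iff.rfl`) closes.
[folklore] -/
theorem GalerkinSteadyZerothLaw_of : GalerkinSteadyZerothLaw := crux_iff.2 (loudWitness_of_subs stub_reachF123 stub_loudF123)

end Summit.AnomalousDissipation.AnomalousDissipation.Cruxes.GalerkinSteadyZerothLaw.StokesContinuumF123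

end
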